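import Literature.AlgebraicTopology.SingularHomology.CohomologyRingChange
import Literature.AlgebraicTopology.SingularHomology.CapProduct
import Literature.AlgebraicTopology.SingularHomology.UniversalCoefficientsProofs
import HarnessLib

/-!
# Change of coefficient ring in singular homology: `g_* : Hₙ(X; R₁) → Hₙ(X; R₂)` for an additive
# map `g : R₁ → R₂`; functoriality, naturality, injectivity, and compatibility with the cap product

Homology companion of `CohomologyRingChange` (`singularCohomology.ringChange f : Hⁿ(X; R) → Hⁿ(X; S)`
for a ring homomorphism `f`). A. Hatcher, *Algebraic Topology* (2002), §2.2 "Homology with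
Coefficients", p. 153: a chain `∑ᵢ nᵢσᵢ` with `nᵢ ∈ G`; p. 165 (proof of Lemma 2.49 and the
paragraph before Cor. 2.51): "a homomorphism `φ : G₁ → G₂` induces chain maps
`Cₙ(X; G₁) → Cₙ(X; G₂)` […] and hence homomorphisms `Hₙ(X; G₁) → Hₙ(X; G₂)`, natural in `X`";
§3.3 p. 239–241 (the cap product `σ ⌢ φ = φ(σ|[v₀…vₚ]) σ|[vₚ…vₙ]` is natural in the coefficients).
Everything here is PROVED on the tree's singular chains (through the concrete model
`SingularSimplex X n →₀ R` of `SingularChainsConcrete`, as `IntegralLattice.baseChangeChain`):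

* `chainCoeffChange g n : Cₙ(X; R₁) →+ Cₙ(X; R₂)`, `∑ rᵢ σᵢ ↦ ∑ g(rᵢ) σᵢ`, for an ADDITIVE map
  `g : R₁ →+ R₂` of commutative coefficient rings; it commutes with `∂` (the boundary has integer
  coefficients), with push-forwards `f_♯`, is functorial in `g`, and for a ring homomorphism `φ`
  it commutes with the Alexander–Whitney cap product with a cochain `ψ`:
  `φ_♯ (c ⌢ ψ) = φ_♯ c ⌢ (φ ∘ ψ)`;
* `singularHomology.coeffChange g X n : Hₙ(X; R₁) →+ Hₙ(X; R₂)`, `[z] ↦ [g_♯ z]`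
  (`coeffChange_homologyπ`), functorial (`coeffChange_comp`, `coeffChange_id`) — hence
  **injective as soon as `g` has an additive left inverse** (`coeffChange_injective_of_leftInverse`;
  e.g. `ℚ ↪ ℂ`, any `ℚ`-linear retraction), natural in `X` (`coeffChange_map`), `φ`-semilinear
  for a ring homomorphism (`coeffChange_smul`), and **compatible with the cap product**:
  `φ_* (a ⌢ z) = φ_* a ⌢ φ_* z` with `φ_* a = singularCohomology.ringChange φ a`
  (`coeffChange_capProduct`).

Consumer: `Literature.AlgebraicGeometry.HodgeTheory.ComplexGysinRational` (the Gysin morphisms of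
smooth projective complex varieties on `H*(–(ℂ); ℂ)` restricted to rational classes are the
rational Gysin morphisms, up to the orientation scalar).

## References

* [HatcherAT2002] A. Hatcher, Algebraic Topology, CUP 2002, §2.2 pp. 153, 165; §3.3 pp. 239–241.
-/

noncomputable section

open CategoryTheory Limits

universe u v

namespace Literature.AlgebraicTopology.SingularHomology

-- the chain modules of the concrete model are `Finsupp`s up to unfolding (as in `IntegralLattice`)
set_option backward.isDefEq.respectTransparency false

open singularChainComplex singularCochainComplex

variable {R₁ R₂ R₃ : Type v} [CommRing R₁] [CommRing R₂] [CommRing R₃]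
variable {X Y : Type u} [TopologicalSpace X] [TopologicalSpace Y]

/-! ### Chains -/

/-- `(-1)ᵏ` acts through `ℤ`. [folklore] -/
private theorem neg_one_pow_smul_eq_zsmul'' (R : Type*) [Ring R] {M : Type*} [AddCommGroup M]
    [Module R M] (k : ℕ) (m : M) : ((-1 : R) ^ k) • m = ((-1 : ℤ) ^ k) • m := by
  rw [← Int.cast_smul_eq_zsmul R, Int.cast_pow, Int.cast_neg, Int.cast_one]

/-- **Additive maps out of `Cₙ(X; R)` agree if they agree on elementary chains** (`Cₙ(X; R)` is the
free module on the singular simplices, Hatcher §2.1; through the concrete model and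
`Finsupp.addHom_ext`). [cite: HatcherAT2002, §2.1] -/
theorem addMonoidHom_ext_single {n : ℕ} {N : Type*} [AddCommMonoid N]
    {f f' : (singularChainComplex R₁ R₁ X).X n →+ N}
    (h : ∀ (σ : SingularSimplex X n) (r : R₁), f (single (R := R₁) σ r) = f' (single (R := R₁) σ r)) :
    f = f' := by
  have hc : f.comp (csingularChainComplex.compHom R₁ R₁ X n).hom.toAddMonoidHom =
      f'.comp (csingularChainComplex.compHom R₁ R₁ X n).hom.toAddMonoidHom := by
    refine Finsupp.addHom_ext fun σ r ↦ ?_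
    simp only [AddMonoidHom.coe_comp, Function.comp_apply, LinearMap.toAddMonoidHom_coe]
    rw [csingularChainComplex.compHom_single]
    exact h σ r
  ext c
  rw [← compHom_compInv_apply n c]
  exact DFunLike.congr_fun hc ((csingularChainComplex.compInv R₁ R₁ X n) c)

/-- **Change of coefficients on singular chains** along an additive map `g : R₁ → R₂`:
`Cₙ(X; R₁) →+ Cₙ(X; R₂)`, `∑ rᵢ σᵢ ↦ ∑ g(rᵢ) σᵢ` (Hatcher §2.2 p. 165: "a homomorphism
`φ : G₁ → G₂` induces chain maps `Cₙ(X; G₁) → Cₙ(X; G₂)`"); through the concrete model.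
[cite: HatcherAT2002, §2.2 p. 165] -/
def chainCoeffChange (g : R₁ →+ R₂) (n : ℕ) :
    (singularChainComplex R₁ R₁ X).X n →+ (singularChainComplex R₂ R₂ X).X n :=
  (csingularChainComplex.compHom R₂ R₂ X n).hom.toAddMonoidHom.comp
    ((Finsupp.mapRange.addMonoidHom g).comp
      (csingularChainComplex.compInv R₁ R₁ X n).hom.toAddMonoidHom)

/-- On elementary chains: `r • σ ↦ g(r) • σ`. [cite: HatcherAT2002, §2.2 p. 165] -/
@[simp]
theorem chainCoeffChange_single (g : R₁ →+ R₂) {n : ℕ} (σ : SingularSimplex X n) (r : R₁) :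
    chainCoeffChange g n (single (R := R₁) σ r) = single (R := R₂) σ (g r) := by
  change (csingularChainComplex.compHom R₂ R₂ X n).hom (Finsupp.mapRange.addMonoidHom g
    ((csingularChainComplex.compInv R₁ R₁ X n).hom (single (R := R₁) σ r))) = _
  rw [csingularChainComplex.compInv_single, Finsupp.mapRange.addMonoidHom_apply,
    Finsupp.mapRange_single, csingularChainComplex.compHom_single]

/-- Functoriality in the coefficient map: `(g' ∘ g)_♯ = g'_♯ ∘ g_♯`. [cite: HatcherAT2002, §2.2 p. 165] -/
theorem chainCoeffChange_comp (g' : R₂ →+ R₃) (g : R₁ →+ R₂) (n : ℕ)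
    (c : (singularChainComplex R₁ R₁ X).X n) :
    chainCoeffChange g' n (chainCoeffChange g n c) = chainCoeffChange (g'.comp g) n c := by
  have key : (chainCoeffChange g' n).comp (chainCoeffChange (X := X) g n) =
      chainCoeffChange (g'.comp g) n :=
    addMonoidHom_ext_single fun σ r ↦ by
      simp only [AddMonoidHom.coe_comp, Function.comp_apply, chainCoeffChange_single]
  exact DFunLike.congr_fun key c

/-- `(id)_♯ = id`. [cite: HatcherAT2002, §2.2 p. 165] -/
theorem chainCoeffChange_id (n : ℕ) (c : (singularChainComplex R₁ R₁ X).X n) :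
    chainCoeffChange (AddMonoidHom.id R₁) n c = c := by
  have key : chainCoeffChange (X := X) (AddMonoidHom.id R₁) n = AddMonoidHom.id _ :=
    addMonoidHom_ext_single fun σ r ↦ by
      simp only [chainCoeffChange_single, AddMonoidHom.id_apply]
  exact DFunLike.congr_fun key c

/-- **`g_♯` is a chain map**: it commutes with the singular boundary, whose coefficients are the
integers `(-1)ⁱ` (Hatcher §2.2 p. 165). [cite: HatcherAT2002, §2.2 p. 165] -/
theorem d_chainCoeffChange (g : R₁ →+ R₂) (i j : ℕ) (c : (singularChainComplex R₁ R₁ X).X i) :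
    (singularChainComplex R₂ R₂ X).d i j (chainCoeffChange g i c) =
      chainCoeffChange g j ((singularChainComplex R₁ R₁ X).d i j c) := by
  by_cases hij : (ComplexShape.down ℕ).Rel i j
  · obtain rfl : j + 1 = i := hij
    have key : ((singularChainComplex R₂ R₂ X).d (j + 1) j).hom.toAddMonoidHom.comp
        (chainCoeffChange g (j + 1)) =
        (chainCoeffChange g j).comp
          ((singularChainComplex R₁ R₁ X).d (j + 1) j).hom.toAddMonoidHom := by
      refine addMonoidHom_ext_single fun σ r ↦ ?_
      simp only [AddMonoidHom.coe_comp, Function.comp_apply, LinearMap.toAddMonoidHom_coe]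
      change (singularChainComplex R₂ R₂ X).d (j + 1) j (chainCoeffChange g (j + 1) (single σ r)) =
        chainCoeffChange g j ((singularChainComplex R₁ R₁ X).d (j + 1) j (single σ r))
      rw [chainCoeffChange_single, singularChainComplex.d_single, singularChainComplex.d_single,
        map_sum]
      refine Finset.sum_congr rfl fun k _ ↦ ?_
      rw [neg_one_pow_smul_eq_zsmul'' R₂, neg_one_pow_smul_eq_zsmul'' R₁, map_zsmul,
        chainCoeffChange_single]
    exact DFunLike.congr_fun key c
  · rw [(singularChainComplex R₂ R₂ X).shape i j hij, (singularChainComplex R₁ R₁ X).shape i j hij]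
    change ((0 : (singularChainComplex R₂ R₂ X).X i ⟶ (singularChainComplex R₂ R₂ X).X j)).hom
        (chainCoeffChange g i c) =
      chainCoeffChange g j
        (((0 : (singularChainComplex R₁ R₁ X).X i ⟶ (singularChainComplex R₁ R₁ X).X j)).hom c)
    rw [ModuleCat.hom_zero, ModuleCat.hom_zero, LinearMap.zero_apply, LinearMap.zero_apply, map_zero]

/-- **`g_♯` is natural in the space**: it commutes with the push-forward `f_♯` of a continuous
map (both act on elementary chains: `r • σ ↦ g(r) • (f ∘ σ)`). [cite: HatcherAT2002, §2.2 p. 165] -/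
theorem chainCoeffChange_map (g : R₁ →+ R₂) (f : C(X, Y)) (n : ℕ)
    (c : (singularChainComplex R₁ R₁ X).X n) :
    chainCoeffChange g n ((singularChainComplex.map R₁ R₁ f).f n c) =
      (singularChainComplex.map R₂ R₂ f).f n (chainCoeffChange g n c) := by
  have key : (chainCoeffChange g n).comp ((singularChainComplex.map R₁ R₁ f).f n).hom.toAddMonoidHom =
      ((singularChainComplex.map R₂ R₂ f).f n).hom.toAddMonoidHom.comp (chainCoeffChange (X := X) g n) := by
    refine addMonoidHom_ext_single fun σ r ↦ ?_
    simp only [AddMonoidHom.coe_comp, Function.comp_apply, LinearMap.toAddMonoidHom_coe]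
    change chainCoeffChange g n ((singularChainComplex.map R₁ R₁ f).f n (single σ r)) =
      (singularChainComplex.map R₂ R₂ f).f n (chainCoeffChange g n (single σ r))
    rw [singularChainComplex.map_f_single, chainCoeffChange_single, chainCoeffChange_single,
      singularChainComplex.map_f_single]
  exact DFunLike.congr_fun key c

/-- **`φ_♯` commutes with the cap product with a cochain** for a ring homomorphism `φ`:
`φ_♯ (c ⌢ ψ) = φ_♯ c ⌢ (φ ∘ ψ)` (on elementary chains both are
`φ(ψ(σ|front) r) • σ|back`; Hatcher §3.3 p. 239). [cite: HatcherAT2002, §3.3 p. 239] -/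
theorem chainCoeffChange_capChain (φ : R₁ →+* R₂) {p q n : ℕ} (h : p + q = n)
    (ψ : SingularSimplex X p → R₁) (c : (singularChainComplex R₁ R₁ X).X n) :
    chainCoeffChange φ.toAddMonoidHom q (capChain R₁ h ψ c) =
      capChain R₂ h (φ ∘ ψ) (chainCoeffChange φ.toAddMonoidHom n c) := by
  have key : (chainCoeffChange φ.toAddMonoidHom q).comp (capChain R₁ h ψ).hom.toAddMonoidHom =
      (capChain R₂ h (φ ∘ ψ)).hom.toAddMonoidHom.comp (chainCoeffChange (X := X) φ.toAddMonoidHom n) := by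
    refine addMonoidHom_ext_single fun σ r ↦ ?_
    simp only [AddMonoidHom.coe_comp, Function.comp_apply, LinearMap.toAddMonoidHom_coe]
    change chainCoeffChange φ.toAddMonoidHom q (capChain R₁ h ψ (single σ r)) =
      capChain R₂ h (φ ∘ ψ) (chainCoeffChange φ.toAddMonoidHom n (single σ r))
    rw [capChain_single, chainCoeffChange_single, chainCoeffChange_single, capChain_single,
      smul_eq_mul, smul_eq_mul, RingHom.toAddMonoidHom_eq_coe, AddMonoidHom.coe_coe, map_mul]
    rfl
  exact DFunLike.congr_fun key c

/-! ### Cycles -/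

/-- `g_♯` on cycles: `Zₙ(X; R₁) → Zₙ(X; R₂)` (`g_♯` is a chain map). [cite: HatcherAT2002, §2.2 p. 165] -/
def cyclesCoeffChange (g : R₁ →+ R₂) (n : ℕ) (z : cycles R₁ R₁ X n) : cycles R₂ R₂ X n :=
  (singularChainComplex R₂ R₂ X).cyclesMk (chainCoeffChange g n (iCycles R₁ R₁ X n z))
    ((ComplexShape.down ℕ).next n) rfl (by
      change (singularChainComplex R₂ R₂ X).d n ((ComplexShape.down ℕ).next n)
        (chainCoeffChange g n (iCycles R₁ R₁ X n z)) = 0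
      rw [d_chainCoeffChange, d_iCycles, map_zero])

/-- The underlying chain of `g_♯ z` is `g_♯` of the underlying chain. [folklore] -/
@[simp]
theorem iCycles_cyclesCoeffChange (g : R₁ →+ R₂) {n : ℕ} (z : cycles R₁ R₁ X n) :
    iCycles R₂ R₂ X n (cyclesCoeffChange g n z) = chainCoeffChange g n (iCycles R₁ R₁ X n z) :=
  (singularChainComplex R₂ R₂ X).i_cyclesMk _ _ _ _

/-- `g_♯` is additive on cycles. [folklore] -/
theorem cyclesCoeffChange_add (g : R₁ →+ R₂) {n : ℕ} (z z' : cycles R₁ R₁ X n) :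
    cyclesCoeffChange g n (z + z') = cyclesCoeffChange g n z + cyclesCoeffChange g n z' :=
  cycles_ext (by rw [map_add, iCycles_cyclesCoeffChange, iCycles_cyclesCoeffChange,
    iCycles_cyclesCoeffChange, map_add, map_add])

/-- `g_♯` respects subtraction on cycles. [folklore] -/
theorem cyclesCoeffChange_sub (g : R₁ →+ R₂) {n : ℕ} (z z' : cycles R₁ R₁ X n) :
    cyclesCoeffChange g n (z - z') = cyclesCoeffChange g n z - cyclesCoeffChange g n z' :=
  cycles_ext (by rw [map_sub, iCycles_cyclesCoeffChange, iCycles_cyclesCoeffChange,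
    iCycles_cyclesCoeffChange, map_sub, map_sub])

/-- **A cycle with zero homology class is a boundary** (`Hₙ = Zₙ / Bₙ`;
`HomologicalComplex.homologyIsCokernel` read on elements of `ModuleCat`), any commutative
coefficient ring. [cite: HatcherAT2002, §2.1] -/
theorem exists_d_eq_iCycles_of_homologyπ_eq_zero' {k : ℕ} (z : cycles R₁ R₁ X k)
    (hz : (singularChainComplex R₁ R₁ X).homologyπ k z = 0) :
    ∃ b : (singularChainComplex R₁ R₁ X).X (k + 1),
      (singularChainComplex R₁ R₁ X).d (k + 1) k b = iCycles R₁ R₁ X k z := by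
  set K := singularChainComplex R₁ R₁ X
  let S : ShortComplex (ModuleCat R₁) :=
    ShortComplex.mk (K.toCycles (k + 1) k) (K.homologyπ k) (K.toCycles_comp_homologyπ (k + 1) k)
  have hS : S.Exact :=
    ShortComplex.exact_of_g_is_cokernel S (K.homologyIsCokernel (k + 1) k (ChainComplex.prev ℕ k))
  obtain ⟨b, hb⟩ := (ShortComplex.moduleCat_exact_iff S).1 hS z hz
  refine ⟨b, ?_⟩
  rw [← iCycles_toCycles]
  exact congrArg (iCycles R₁ R₁ X k) hb

/-- **`g_♯` respects homology classes**: homologous cycles have homologous images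
(`g_♯ ∂b = ∂ g_♯ b`). [cite: HatcherAT2002, §2.2 p. 165] -/
theorem homologyπ_cyclesCoeffChange_eq (g : R₁ →+ R₂) {n : ℕ} {z z' : cycles R₁ R₁ X n}
    (h : (singularChainComplex R₁ R₁ X).homologyπ n z = (singularChainComplex R₁ R₁ X).homologyπ n z') :
    (singularChainComplex R₂ R₂ X).homologyπ n (cyclesCoeffChange g n z) =
      (singularChainComplex R₂ R₂ X).homologyπ n (cyclesCoeffChange g n z') := by
  have h0 : (singularChainComplex R₁ R₁ X).homologyπ n (z - z') = 0 := by
    rw [map_sub, h, sub_self]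
  obtain ⟨b, hb⟩ := exists_d_eq_iCycles_of_homologyπ_eq_zero' (z - z') h0
  have key : cyclesCoeffChange g n z - cyclesCoeffChange g n z' =
      toCycles R₂ R₂ X (n + 1) n (chainCoeffChange g (n + 1) b) :=
    cycles_ext (by rw [← cyclesCoeffChange_sub, iCycles_cyclesCoeffChange, iCycles_toCycles,
      d_chainCoeffChange, hb])
  rw [← sub_eq_zero, ← map_sub, key, homologyπ_toCycles]

/-! ### Homology -/

/-- Every homology class is the class of a cycle (surjectivity of `Zₙ → Hₙ`). [cite: HatcherAT2002, §2.1] -/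
theorem homologyπ_surjective' (n : ℕ) :
    Function.Surjective ((singularChainComplex R₁ R₁ X).homologyπ n) := fun x ↦ by
  induction x using singularHomology_induction_on with
  | h z => exact ⟨z, rfl⟩

/-- `g_*` on classes (through a chosen representing cycle). [folklore] -/
def coeffChangeClass (g : R₁ →+ R₂) (n : ℕ) (x : singularHomology R₁ R₁ X n) :
    singularHomology R₂ R₂ X n :=
  (singularChainComplex R₂ R₂ X).homologyπ n
    (cyclesCoeffChange g n (Classical.choose (homologyπ_surjective' n x)))

/-- `coeffChangeClass g n [z] = [g_♯ z]`. [folklore] -/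
theorem coeffChangeClass_homologyπ (g : R₁ →+ R₂) {n : ℕ} (z : cycles R₁ R₁ X n) :
    coeffChangeClass g n ((singularChainComplex R₁ R₁ X).homologyπ n z) =
      (singularChainComplex R₂ R₂ X).homologyπ n (cyclesCoeffChange g n z) :=
  homologyπ_cyclesCoeffChange_eq g
    (Classical.choose_spec (homologyπ_surjective' n ((singularChainComplex R₁ R₁ X).homologyπ n z)))

variable (X) in
/-- **Change of coefficients in singular homology**: the additive map
`g_* : Hₙ(X; R₁) → Hₙ(X; R₂)`, `[∑ rᵢ σᵢ] ↦ [∑ g(rᵢ) σᵢ]`, induced by an additive map `g : R₁ → R₂`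
of coefficient rings (Hatcher §2.2 p. 165: "and hence homomorphisms `Hₙ(X; G₁) → Hₙ(X; G₂)`").
[cite: HatcherAT2002, §2.2 p. 165] -/
def singularHomology.coeffChange (g : R₁ →+ R₂) (n : ℕ) :
    singularHomology R₁ R₁ X n →+ singularHomology R₂ R₂ X n where
  toFun := coeffChangeClass g n
  map_zero' := by
    have h0 : (0 : singularHomology R₁ R₁ X n) = (singularChainComplex R₁ R₁ X).homologyπ n 0 :=
      (map_zero _).symm
    rw [h0, coeffChangeClass_homologyπ]
    have : cyclesCoeffChange g n (0 : cycles R₁ R₁ X n) = 0 :=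
      cycles_ext (by rw [iCycles_cyclesCoeffChange, map_zero, map_zero, map_zero])
    rw [this, map_zero]
  map_add' x y := by
    induction x using singularHomology_induction_on with
    | h u =>
      induction y using singularHomology_induction_on with
      | h v =>
        rw [← map_add, coeffChangeClass_homologyπ, coeffChangeClass_homologyπ,
          coeffChangeClass_homologyπ, cyclesCoeffChange_add, map_add]

/-- **`g_* [z] = [g_♯ z]`**. [cite: HatcherAT2002, §2.2 p. 165] -/
@[simp]
theorem singularHomology.coeffChange_homologyπ (g : R₁ →+ R₂) {n : ℕ} (z : cycles R₁ R₁ X n) :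
    singularHomology.coeffChange X g n ((singularChainComplex R₁ R₁ X).homologyπ n z) =
      (singularChainComplex R₂ R₂ X).homologyπ n (cyclesCoeffChange g n z) :=
  coeffChangeClass_homologyπ g z

/-- **Functoriality**: `g'_* (g_* x) = (g' ∘ g)_* x`. [cite: HatcherAT2002, §2.2 p. 165] -/
theorem singularHomology.coeffChange_comp (g' : R₂ →+ R₃) (g : R₁ →+ R₂) {n : ℕ}
    (x : singularHomology R₁ R₁ X n) :
    singularHomology.coeffChange X g' n (singularHomology.coeffChange X g n x) =
      singularHomology.coeffChange X (g'.comp g) n x := by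
  induction x using singularHomology_induction_on with
  | h z =>
    rw [singularHomology.coeffChange_homologyπ, singularHomology.coeffChange_homologyπ,
      singularHomology.coeffChange_homologyπ]
    congr 1
    exact cycles_ext (by rw [iCycles_cyclesCoeffChange, iCycles_cyclesCoeffChange,
      iCycles_cyclesCoeffChange, chainCoeffChange_comp])

/-- **Identity**: `(id)_* x = x`. [cite: HatcherAT2002, §2.2 p. 165] -/
theorem singularHomology.coeffChange_id {n : ℕ} (x : singularHomology R₁ R₁ X n) :
    singularHomology.coeffChange X (AddMonoidHom.id R₁) n x = x := by
  induction x using singularHomology_induction_on with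
  | h z =>
    rw [singularHomology.coeffChange_homologyπ]
    congr 1
    exact cycles_ext (by rw [iCycles_cyclesCoeffChange, chainCoeffChange_id])

/-- **Injectivity**: if `g` has an additive left inverse `ρ` (`ρ ∘ g = id`; e.g. `ℚ ↪ ℂ` with a
`ℚ`-linear retraction), then `g_* : Hₙ(X; R₁) → Hₙ(X; R₂)` is injective (`ρ_* ∘ g_* = id`).
[cite: HatcherAT2002, §2.2 p. 165] -/
theorem singularHomology.coeffChange_injective_of_leftInverse (g : R₁ →+ R₂) (ρ : R₂ →+ R₁)
    (h : ρ.comp g = AddMonoidHom.id R₁) (n : ℕ) :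
    Function.Injective (singularHomology.coeffChange X g n) := by
  refine Function.LeftInverse.injective (g := singularHomology.coeffChange X ρ n) fun x ↦ ?_
  rw [singularHomology.coeffChange_comp, h, singularHomology.coeffChange_id]

/-- **Naturality in the space**: `g_* (f_* x) = f_* (g_* x)` for `f : X → Y` continuous
(Hatcher §2.2 p. 165: "natural in `X`"). [cite: HatcherAT2002, §2.2 p. 165] -/
theorem singularHomology.coeffChange_map (g : R₁ →+ R₂) (f : C(X, Y)) {n : ℕ}
    (x : singularHomology R₁ R₁ X n) :
    singularHomology.coeffChange Y g n (singularHomology.map R₁ R₁ f n x) =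
      singularHomology.map R₂ R₂ f n (singularHomology.coeffChange X g n x) := by
  induction x using singularHomology_induction_on with
  | h z =>
    rw [singularHomology.map_homologyπ, singularHomology.coeffChange_homologyπ,
      singularHomology.coeffChange_homologyπ, singularHomology.map_homologyπ]
    congr 1
    exact cycles_ext (by rw [iCycles_cyclesCoeffChange, iCycles_cyclesMap, iCycles_cyclesMap,
      iCycles_cyclesCoeffChange, chainCoeffChange_map])

/-- **`φ`-semilinearity** for a ring homomorphism `φ`: `φ_* (r • x) = φ(r) • φ_* x`.
[cite: HatcherAT2002, §2.2 p. 165] -/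
theorem singularHomology.coeffChange_smul (φ : R₁ →+* R₂) {n : ℕ} (r : R₁)
    (x : singularHomology R₁ R₁ X n) :
    singularHomology.coeffChange X φ.toAddMonoidHom n (r • x) =
      φ r • singularHomology.coeffChange X φ.toAddMonoidHom n x := by
  induction x using singularHomology_induction_on with
  | h z =>
    rw [← map_smul, singularHomology.coeffChange_homologyπ, singularHomology.coeffChange_homologyπ,
      ← map_smul]
    congr 1
    refine cycles_ext ?_
    rw [iCycles_cyclesCoeffChange, map_smul (iCycles R₁ R₁ X n).hom r z,
      map_smul (iCycles R₂ R₂ X n).hom (φ r), iCycles_cyclesCoeffChange]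
    have key : (chainCoeffChange (X := X) φ.toAddMonoidHom n).comp
        (DistribSMul.toAddMonoidHom ((singularChainComplex R₁ R₁ X).X n) r) =
        (DistribSMul.toAddMonoidHom ((singularChainComplex R₂ R₂ X).X n) (φ r)).comp
          (chainCoeffChange (X := X) φ.toAddMonoidHom n) := by
      refine addMonoidHom_ext_single fun σ s ↦ ?_
      simp only [AddMonoidHom.coe_comp, Function.comp_apply, DistribSMul.toAddMonoidHom_apply]
      rw [← singularChainComplex.single_smul, smul_eq_mul, chainCoeffChange_single,
        chainCoeffChange_single, ← singularChainComplex.single_smul, smul_eq_mul,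
        RingHom.toAddMonoidHom_eq_coe, AddMonoidHom.coe_coe, map_mul]
    exact DFunLike.congr_fun key (iCycles R₁ R₁ X n z)

/-- **Compatibility with the cap product** for a ring homomorphism `φ`:
`φ_* (a ⌢ z) = φ_* a ⌢ φ_* z`, where `φ_* a = singularCohomology.ringChange φ a` is the change of
ring on cohomology (on representatives: `φ_♯ (c ⌢ u) = φ_♯ c ⌢ (φ ∘ u)`,
`chainCoeffChange_capChain`; Hatcher §3.3 pp. 239–241). [cite: HatcherAT2002, §3.3 pp. 239–241] -/
theorem singularHomology.coeffChange_capProduct (φ : R₁ →+* R₂) {p q n : ℕ} (h : p + q = n)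
    (a : singularCohomology R₁ R₁ X p) (z : singularHomology R₁ R₁ X n) :
    singularHomology.coeffChange X φ.toAddMonoidHom q (capProduct h a z) =
      capProduct h (singularCohomology.ringChange φ X p a)
        (singularHomology.coeffChange X φ.toAddMonoidHom n z) := by
  induction a using singularCohomology_induction_on with
  | h u =>
    induction z using singularHomology_induction_on with
    | h c =>
      rw [capProduct_π_homologyπ, singularHomology.coeffChange_homologyπ,
        singularHomology.coeffChange_homologyπ, singularCohomology.ringChange_π,
        capProduct_π_homologyπ]
      congr 1
      refine cycles_ext ?_
      rw [iCycles_cyclesCoeffChange, iCycles_capCycles, iCycles_capCycles, iCycles_cyclesCoeffChange,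
        chainCoeffChange_capChain, ← coFn_eq u, ← coFn_eq (cocyclesRingChange φ p u),
        coFn_cocyclesRingChange]

end Literature.AlgebraicTopology.SingularHomology

end
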